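import Literature.AlgebraicGeometry.Deformation.BaseChangeKernelIdeal
import HarnessLib

/-!
# The ideal of a closed immersion after base change over an affine base: `𝓘_{Z ×_A V(J)} = J · 𝒪_Z`

Topic `Literature/AlgebraicGeometry/Morphisms`, namespace `Literature.AlgebraicGeometry.Morphisms`. THEOREMS only (no
definition, no instance, no notation, no named fact); universe-polymorphic `Scheme.{u}`.

THE PRINT. Görtz–Wedhorn, *Algebraic Geometry I*, Prop. 4.20 (p. 104): for `f : X → Spec A` and an ideal `𝔞 ⊆ A`, «we have
an identity of closed subschemes `f⁻¹(V(𝔞)) = V(𝔞𝒪_X)`» — the ideal sheaf of the base change `Z ×_{Spec A} V(𝔞) ↪ Z` of a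
closed subscheme `V(𝔞) ↪ Spec A` along ANY `p : Z → Spec A` is the ideal sheaf generated by `p♯(𝔞)`.

WHAT IS HERE. For a CLOSED IMMERSION `g : Y ↪ Spec A` (not necessarily written as `Spec (A ↠ A⧸J)`), `p : Z → Spec A`, and
a cartesian square `IsPullback k pY p g` (`k : Z_Y ⟶ Z`, `pY : Z_Y ⟶ Y`):
* `ker_eq_ofIdealTop_of_isPullback` — `k.ker = ofIdealTop ((g.ker.ideal ⊤).map p.appTop)` («`𝓘_{Z_Y} = J·𝒪_Z`», `J := 𝓘_Y(⊤)`);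
* `ker_ideal_eq_map_of_isPullback` — on an affine open `W ⊆ Z`: `k.ker.ideal W = J · Γ(Z, W)` (extension along
  `p♯ : A = Γ(Spec A, ⊤) → Γ(Z, W)`).
Road: `Y ≅ Spec Γ(Y, ⊤)` (closed subschemes of affine schemes are affine, Mathlib
`IsClosedImmersion.isAffine_surjective_of_isAffine`) turns `g` into `Spec` of the surjection
`φ = g♯ : A → Γ(Y, ⊤)` (Mathlib `Scheme.toSpecΓ_naturality`), and ★ `Deformation.ker_eq_idealSheafOfIdeal_ker` (the same
statement for base change along `Spec (R ↠ R')`) applies; `ker φ = 𝓘_Y(⊤)` read through `ΓSpecIso`.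

Cell `hodgecm-mathlib`, F-5 §3 (β′) brick (R1) for `Modules/TwistPushforwardClosedBaseChange` (B-p16 (g16)): the binder
`hker : k.ker = ofIdealTop ((g.ker.ideal ⊤).map p.appTop)` of its heads is discharged by `exact` on the first theorem.
HC_CM is proved only modulo the 7 printed citations until rung 0 closes — nothing here bears on a summit statement.

## References
* U. Görtz, T. Wedhorn, *Algebraic Geometry I: Schemes*, 2nd ed. (2020), Prop. 4.20 (p. 104). [GortzWedhorn2020]
* R. Hartshorne, *Algebraic Geometry* (1977), II Ex. 3.11 (a) (closed immersions are stable under base extension). [Hartshorne1977]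
* The Stacks Project, Tag 01HQ (closed immersions of affine schemes), Tag 01JU (base change). [StacksProject]
-/

noncomputable section

open CategoryTheory CategoryTheory.Limits AlgebraicGeometry TopologicalSpace Opposite Scheme.IdealSheafData

universe u

namespace Literature.AlgebraicGeometry.Morphisms

variable {A : Type u} [CommRing A] {Y Z ZY : Scheme.{u}} {g : Y ⟶ Spec (.of A)} [IsClosedImmersion g]
  {p : Z ⟶ Spec (.of A)} {k : ZY ⟶ Z} {pY : ZY ⟶ Y}

/-- **`𝓘_{Z ×_A Y} = 𝓘_Y(⊤) · 𝒪_Z`** for a closed immersion `g : Y ↪ Spec A` and a cartesian square `Z_Y = Z ×_{Spec A} Y`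
(`k : Z_Y ⟶ Z` the base change of `g` along `p : Z → Spec A`): the ideal sheaf of `k` is the ideal sheaf generated by the
image of `J = 𝓘_Y(⊤) ⊆ A` under `p♯`. [cite: GortzWedhorn2020, Prop. 4.20 (p. 104)] -/
theorem ker_eq_ofIdealTop_of_isPullback (H : IsPullback k pY p g) :
    k.ker = ofIdealTop ((g.ker.ideal ⟨⊤, isAffineOpen_top _⟩).map p.appTop.hom) := by
  -- `Y` is affine and `g♯ : A → Γ(Y, ⊤)` is surjective
  obtain ⟨hY, hsurj⟩ := IsClosedImmersion.isAffine_surjective_of_isAffine g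
  let φ : A →+* Γ(Y, ⊤) := Deformation.specStructureMap g
  have hφ : Function.Surjective φ :=
    hsurj.comp (Scheme.ΓSpecIso (.of A)).symm.commRingCatIsoToRingEquiv.surjective
  -- `g = (Y ≅ Spec Γ(Y, ⊤)) ≫ Spec φ`
  have hg : g = Y.isoSpec.hom ≫ Spec.map (CommRingCat.ofHom φ) := by
    have h1 : g ≫ (Spec (.of A)).toSpecΓ = Y.toSpecΓ ≫ Spec.map g.appTop := Scheme.toSpecΓ_naturality g
    rw [← cancel_mono (Spec.map (Scheme.ΓSpecIso (.of A)).inv), Category.assoc,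
      toSpecΓ_SpecMap_ΓSpecIso_inv, Category.comp_id, Category.assoc, ← Spec.map_comp] at h1
    exact h1
  -- the square over `Spec φ`
  have H' : IsPullback k (pY ≫ Y.isoSpec.hom) p (Spec.map (CommRingCat.ofHom φ)) :=
    H.of_iso (Iso.refl _) (Iso.refl _) Y.isoSpec (Iso.refl _) (by simp) (by simp) (by simp)
      (by simpa using hg)
  rw [Deformation.ker_eq_idealSheafOfIdeal_ker φ hφ H', Deformation.idealSheafOfIdeal]
  congr 1
  -- `ker φ · Γ(Z, ⊤) = 𝓘_Y(⊤) · Γ(Z, ⊤)` read through `ΓSpecIso`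
  rw [Scheme.Hom.ker_apply]
  change (RingHom.ker (g.appTop.hom.comp (Scheme.ΓSpecIso (.of A)).inv.hom)).map
      (p.appTop.hom.comp (Scheme.ΓSpecIso (.of A)).inv.hom) = (RingHom.ker (g.app ⊤).hom).map p.appTop.hom
  have hs : Function.Surjective (Scheme.ΓSpecIso (.of A)).inv.hom :=
    (Scheme.ΓSpecIso (.of A)).symm.commRingCatIsoToRingEquiv.surjective
  rw [← RingHom.comap_ker, ← Ideal.map_map, Ideal.map_comap_of_surjective _ hs]
  rfl

/-- **Sections form**: on an affine open `W ⊆ Z`, the ideal of `Z ×_A Y ↪ Z` is the extension `𝓘_Y(⊤) · Γ(Z, W)` of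
`J = 𝓘_Y(⊤) ⊆ A = Γ(Spec A, ⊤)` along `p♯ : Γ(Spec A, ⊤) → Γ(Z, W)`. [cite: GortzWedhorn2020, Prop. 4.20 (p. 104)] -/
theorem ker_ideal_eq_map_of_isPullback (H : IsPullback k pY p g) (W : Z.affineOpens) :
    k.ker.ideal W = (g.ker.ideal ⟨⊤, isAffineOpen_top _⟩).map (p.appLE ⊤ W le_top).hom := by
  rw [ker_eq_ofIdealTop_of_isPullback H, ofIdealTop_ideal, Ideal.map_map, ← CommRingCat.hom_comp]
  rfl

end Literature.AlgebraicGeometry.Morphisms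

end
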